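import Literature.NumberTheory.EllipticCurves.ZpExtensionEisensteinTwistDualityForm
import HarnessLib

/-!
# Perfectness of the scalar form `(c₁ ⊗ a₁, c₂ ⊗ a₂) ↦ c₁ c₂ ι(eb(a₁, a₂))` over ANY commutative ring carrying
# Frobenius data (a `ℤ/n`-valued form with dual families) — the `perfect` field of Howard's H.4 for `M ⊗ 𝒪`

Topic `NumberTheory/EllipticCurves` (sequel to `ZpExtensionEisensteinTwistDualityForm`, whose §2 defines the
`𝒪`-bilinear `scalarForm ι eb : (𝒪 ⊗ M₁) × (𝒪 ⊗ M₂) → 𝒪` for every commutative ring `𝒪`, every ring map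
`ι : ℤ/n → 𝒪` and every bi-additive `eb : M₁ × M₂ → ℤ/n`). THEOREMS ONLY; no definition, no named fact, no instance,
no notation, no `sorry`.

Howard 2004, §1.3 hypothesis H.4 (tree `Literature.NumberTheory.GaloisCohomology.Howard2004.DualityDatum`) asks, on a
level module over the level ring `R`, for an `R`-bilinear `e` which is PERFECT in the `R`-valued sense:
`x ↦ e(x, ·)` is a bijection onto `Hom_R(·, R)` (`Function.Bijective ⇑e`). For the Eisenstein levels
`E[p^k] ⊗ A_{m,k}(ψ)` (`R = A_{m,k} = Λ/(T^m + p, p^k)`) the tree proves this in `ZpExtensionEisensteinTwistDualityForm`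
(`eisensteinDualityForm_bijective`) through the tail form of `A_{m,k}`, its dual family `[πᵢ^*]` and the Frobenius
reciprocity of `IwasawaAlgebraEisensteinQuotientReciprocity` — all hard-wired to `A_{m,k}`. This file proves the SAME
statement ONCE for every commutative ring `𝒪` equipped with «Frobenius data» modulo `n`:

* an additive `lam : 𝒪 → ℤ/n` (a tail / Frobenius form),
* finite families `v, v^* : Fin d → 𝒪` which are `lam`-DUAL: `lam(vᵢ v^*ⱼ) = δᵢⱼ`, and
* the EXPANSION `c = ∑ᵢ ι(lam(c v^*ᵢ)) vᵢ` of every `c ∈ 𝒪`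

(for a monogenic `𝒪 = (ℤ/n)[x]` these are the power basis, the tail-dual basis and the expansion formula of the tree's
`Literature.RingTheory.CompleteIntersection.MonogenicDualizingForm`; both `A_{m,k}` and Howard's Shapiro level rings
`Λ/(ω_k, p^k) = (ℤ/p^k)[T]/(ω_k)` qualify). Then, for `eb` LEFT-non-degenerate and EXHAUSTING `Hom(M₂, ℤ/n)`:

* §1 bookkeeping on the carrier `CoeffExtension ℤ 𝒪 M = 𝒪 ⊗_ℤ M` (pure tensors, `ι(z) = z.val`,
  `lam(ι(z) c) = z · lam(c)`), and **coordinates** `x = ∑ᵢ vᵢ ⊗ wᵢ` of every `x ∈ 𝒪 ⊗ M`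
  (`exists_eq_sum_tmul_of_expansion`);
* §2 the **evaluation formula** `lam(e(∑ᵢ vᵢ ⊗ wᵢ, v^*ⱼ ⊗ b)) = eb(wⱼ, b)` (`apply_scalarForm_sum_tmul_tmul`);
* §3 **`scalarForm ι eb` is injective** (`scalarForm_injective_of_expansion`), **surjective onto
  `Hom_𝒪(𝒪 ⊗ M₂, 𝒪)`** (`scalarForm_surjective_of_expansion`: for an `𝒪`-linear `F` take `wⱼ` with
  `eb(wⱼ, ·) = lam(F(v^*ⱼ ⊗ ·))` and `x = ∑ⱼ vⱼ ⊗ wⱼ`; `e(x, ·)` and `F` agree on `1 ⊗ b` by the expansion formula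
  and are `𝒪`-linear), hence **bijective** (`scalarForm_bijective_of_expansion`) — a direct coordinate proof which
  needs neither the Pontryagin detour nor Frobenius reciprocity.

WHY (cell `pub/bsd-print-x9`, shared μ-crux, the Λ-adic SOURCE setting `S_Λ` of the (F-411) fact): the H.4 datum
`Dsrc : ∀ j, DualityDatum p cd (𝐓_j) (Λ/(ω_{j+1}, p^{j+1}))` on the Shapiro levels `𝐓_j = E_K[p^{j+1}] ⊗ Λ/(ω_{j+1},
p^{j+1})` needs exactly this perfectness over the ring `Λ/(ω_k, p^k)` (sequel files); the Eisenstein case is recovered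
with `v = [T^i]`, `v^* = [πᵢ^*]`, `lam = λ_k`. BSD is not proved by any of this.

References: [Howard2004HeegnerKolyvagin] B. Howard, Compositio Math. 140 (2004), §1.3 (H.4, «perfect»), Lemma 2.1.1,
§2.1; [DeSmitRubinSchoof1997] Prop. 2.1 / Cor. 2.2 (Tate: dual bases of a free algebra with a Frobenius form).
-/

noncomputable section

open scoped TensorProduct

universe v w w₁ w₂

namespace Literature.NumberTheory.EllipticCurves

open Literature.NumberTheory.GaloisRepresentations

/-! ## §1 Pure tensors, `ι(z) = z.val`, and coordinates in `𝒪 ⊗ M` -/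

section Carrier

variable {𝒪 : Type v} [CommRing 𝒪] {M : Type w} [AddCommGroup M]

/-- `c ⊗ (a + b) = c ⊗ a + c ⊗ b` in `CoeffExtension ℤ 𝒪 M`. [cite: Howard2004HeegnerKolyvagin, §2.2 (𝐓/I𝐓 = T ⊗ Λ/I)] -/
theorem CoeffExtension.tmul_add' (c : 𝒪) (a b : M) :
    (CoeffExtension.tmul c (a + b) : CoeffExtension ℤ 𝒪 M) = CoeffExtension.tmul c a + CoeffExtension.tmul c b :=
  TensorProduct.tmul_add c a b

/-- `(c + c') ⊗ a = c ⊗ a + c' ⊗ a` in `CoeffExtension ℤ 𝒪 M`. [cite: Howard2004HeegnerKolyvagin, §2.2 (𝐓/I𝐓 = T ⊗ Λ/I)] -/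
theorem CoeffExtension.add_tmul' (c c' : 𝒪) (a : M) :
    (CoeffExtension.tmul (c + c') a : CoeffExtension ℤ 𝒪 M) = CoeffExtension.tmul c a + CoeffExtension.tmul c' a :=
  TensorProduct.add_tmul c c' a

/-- `c ⊗ 0 = 0` in `CoeffExtension ℤ 𝒪 M`. [cite: Howard2004HeegnerKolyvagin, §2.2 (𝐓/I𝐓 = T ⊗ Λ/I)] -/
theorem CoeffExtension.tmul_zero' (c : 𝒪) : (CoeffExtension.tmul c (0 : M) : CoeffExtension ℤ 𝒪 M) = 0 :=
  TensorProduct.tmul_zero _ c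

/-- Scalars pass into the first factor: `c' • (c ⊗ a) = (c' c) ⊗ a`. [cite: Howard2004HeegnerKolyvagin, §2.2 (𝐓/I𝐓 = T ⊗ Λ/I)] -/
theorem CoeffExtension.smul_tmul_eq (c' c : 𝒪) (a : M) :
    c' • (CoeffExtension.tmul c a : CoeffExtension ℤ 𝒪 M) = CoeffExtension.tmul (c' * c) a :=
  TensorProduct.smul_tmul' c' c a

/-- `(m c) ⊗ a = c ⊗ (m a)` for `m : ℕ`. [cite: Howard2004HeegnerKolyvagin, §2.2 (𝐓/I𝐓 = T ⊗ Λ/I)] -/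
theorem CoeffExtension.tmul_natCast_mul (m : ℕ) (c : 𝒪) (a : M) :
    (CoeffExtension.tmul ((m : 𝒪) * c) a : CoeffExtension ℤ 𝒪 M) = CoeffExtension.tmul c (m • a) := by
  rw [← nsmul_eq_mul]
  have h1 : (CoeffExtension.tmul (m • c) a : CoeffExtension ℤ 𝒪 M) = m • CoeffExtension.tmul c a :=
    map_nsmul (AddMonoidHom.mk' (fun c : 𝒪 => (CoeffExtension.tmul c a : CoeffExtension ℤ 𝒪 M))
      (fun c c' => CoeffExtension.add_tmul' c c' a)) m c
  have h2 : (CoeffExtension.tmul c (m • a) : CoeffExtension ℤ 𝒪 M) = m • CoeffExtension.tmul c a :=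
    map_nsmul (AddMonoidHom.mk' (fun a : M => (CoeffExtension.tmul c a : CoeffExtension ℤ 𝒪 M))
      (fun a a' => CoeffExtension.tmul_add' c a a')) m a
  rw [h1, h2]

variable {n : ℕ} [NeZero n] (ι : ZMod n →+* 𝒪) (lam : 𝒪 →+ ZMod n)

/-- A ring map `ι : ℤ/n → 𝒪` is `z ↦ z.val`. [cite: Howard2004HeegnerKolyvagin, §2.2 (A_𝔮/p^k as a ℤ/p^k-algebra)] -/
theorem ringHom_zmod_apply_eq_natCast (z : ZMod n) : ι z = (z.val : 𝒪) := by
  conv_lhs => rw [← ZMod.natCast_zmod_val z]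
  rw [map_natCast]

/-- **Every additive `lam : 𝒪 → ℤ/n` is `ℤ/n`-linear along `ι`**: `lam(ι(z) c) = z · lam(c)`.
[cite: Howard2004HeegnerKolyvagin, §2.1 (the ℤ_p-linear functional 𝒟_𝔭 → ℚ_p/ℤ_p)] -/
theorem map_ringHom_zmod_mul (z : ZMod n) (c : 𝒪) : lam (ι z * c) = z * lam c := by
  rw [ringHom_zmod_apply_eq_natCast, ← nsmul_eq_mul, map_nsmul, nsmul_eq_mul, ZMod.natCast_zmod_val]

variable {d : ℕ} (v vd : Fin d → 𝒪) (hexp : ∀ c : 𝒪, c = ∑ i, ι (lam (c * vd i)) * v i)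

include hexp in
/-- **Coordinates**: if every `c ∈ 𝒪` expands as `c = ∑ᵢ ι(lam(c v^*ᵢ)) vᵢ`, then every element of `𝒪 ⊗ M` is
`∑ᵢ vᵢ ⊗ wᵢ` (on a pure tensor `c ⊗ b` take `wᵢ = lam(c v^*ᵢ).val • b`). [cite: Howard2004HeegnerKolyvagin, Lemma 2.1.1 and §2.2 (T_𝔮 = 𝐓 ⊗_Λ S_𝔮)]
[cite: DeSmitRubinSchoof1997, Cor. 2.2] -/
theorem exists_eq_sum_tmul_of_expansion (x : CoeffExtension ℤ 𝒪 M) :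
    ∃ w : Fin d → M, x = ∑ i, CoeffExtension.tmul (v i) (w i) := by
  induction x using CoeffExtension.induction_on with
  | zero => exact ⟨0, by simp only [Pi.zero_apply, CoeffExtension.tmul_zero', Finset.sum_const_zero]⟩
  | tmul c b =>
    refine ⟨fun i => (lam (c * vd i)).val • b, ?_⟩
    have hf := map_sum (AddMonoidHom.mk' (fun c : 𝒪 => (CoeffExtension.tmul c b : CoeffExtension ℤ 𝒪 M))
      (fun c c' => CoeffExtension.add_tmul' c c' b)) (fun i => ι (lam (c * vd i)) * v i) Finset.univ
    conv_lhs => rw [hexp c]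
    refine hf.trans (Finset.sum_congr rfl fun i _ => ?_)
    change (CoeffExtension.tmul (ι (lam (c * vd i)) * v i) b : CoeffExtension ℤ 𝒪 M) = _
    rw [ringHom_zmod_apply_eq_natCast, CoeffExtension.tmul_natCast_mul]
  | add x y hx hy =>
    obtain ⟨a, rfl⟩ := hx
    obtain ⟨b, rfl⟩ := hy
    refine ⟨a + b, ?_⟩
    rw [← Finset.sum_add_distrib]
    exact Finset.sum_congr rfl fun i _ => (CoeffExtension.tmul_add' _ (a i) (b i)).symm

end Carrier

/-! ## §2 The evaluation formula -/

section Evaluation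

variable {𝒪 : Type v} [CommRing 𝒪] {n : ℕ} [NeZero n] (ι : ZMod n →+* 𝒪) (lam : 𝒪 →+ ZMod n)
  {d : ℕ} (v vd : Fin d → 𝒪) (hδ : ∀ i j, lam (v i * vd j) = if i = j then 1 else 0)
  {M₁ : Type w₁} {M₂ : Type w₂} [AddCommGroup M₁] [AddCommGroup M₂] (eb : M₁ →+ M₂ →+ ZMod n)

include hδ in
/-- **Evaluation formula**: `lam(e(∑ᵢ vᵢ ⊗ wᵢ, v^*ⱼ ⊗ b)) = eb(wⱼ, b)` for `e = scalarForm ι eb` and `lam`-dual families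
(`lam(vᵢ v^*ⱼ) = δᵢⱼ` kills the other terms). [cite: DeSmitRubinSchoof1997, Cor. 2.2 (case n = 1)] [cite: Howard2004HeegnerKolyvagin, Lemma 2.1.1] -/
theorem apply_scalarForm_sum_tmul_tmul (w : Fin d → M₁) (j : Fin d) (b : M₂) :
    lam (scalarForm ι eb (∑ i, CoeffExtension.tmul (v i) (w i)) (CoeffExtension.tmul (vd j) b)) = eb (w j) b := by
  rw [map_sum, LinearMap.sum_apply, map_sum, Finset.sum_eq_single j]
  · rw [scalarForm_tmul_tmul, mul_comm, map_ringHom_zmod_mul, hδ, if_pos rfl, mul_one]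
  · intro i _ hij
    rw [scalarForm_tmul_tmul, mul_comm, map_ringHom_zmod_mul, hδ, if_neg hij, mul_zero]
  · intro h; exact absurd (Finset.mem_univ j) h

end Evaluation

/-! ## §3 Injectivity, surjectivity, bijectivity -/

section Perfect

variable {𝒪 : Type v} [CommRing 𝒪] {n : ℕ} [NeZero n] (ι : ZMod n →+* 𝒪) (lam : 𝒪 →+ ZMod n)
  {d : ℕ} (v vd : Fin d → 𝒪) (hδ : ∀ i j, lam (v i * vd j) = if i = j then 1 else 0)
  (hexp : ∀ c : 𝒪, c = ∑ i, ι (lam (c * vd i)) * v i)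
  {M₁ : Type w₁} {M₂ : Type w₂} [AddCommGroup M₁] [AddCommGroup M₂] (eb : M₁ →+ M₂ →+ ZMod n)

include hδ hexp in
/-- **Injectivity of `x ↦ e(x, ·)`** for `e = scalarForm ι eb` with `eb` LEFT-non-degenerate: write `x = ∑ᵢ vᵢ ⊗ wᵢ`
and test against `v^*ⱼ ⊗ b`. [cite: Howard2004HeegnerKolyvagin, §1.3 (H.4, «perfect») and Lemma 2.1.1] [cite: DeSmitRubinSchoof1997, Cor. 2.2] -/
theorem scalarForm_injective_of_expansion (hnd : ∀ w : M₁, (∀ b : M₂, eb w b = 0) → w = 0) :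
    Function.Injective (scalarForm ι eb : CoeffExtension ℤ 𝒪 M₁ → (CoeffExtension ℤ 𝒪 M₂ →ₗ[𝒪] 𝒪)) := by
  refine (injective_iff_map_eq_zero (scalarForm ι eb)).mpr fun x hx => ?_
  obtain ⟨w, rfl⟩ := exists_eq_sum_tmul_of_expansion ι lam v vd hexp x
  have hw : ∀ j, w j = 0 := fun j => hnd _ fun b => by
    rw [← apply_scalarForm_sum_tmul_tmul ι lam v vd hδ eb w j b, hx, LinearMap.zero_apply, map_zero]
  simp only [hw, CoeffExtension.tmul_zero', Finset.sum_const_zero]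

omit [NeZero n] in
include hexp in
/-- **Surjectivity of `x ↦ e(x, ·)` onto `Hom_𝒪(𝒪 ⊗ M₂, 𝒪)`** for `e = scalarForm ι eb` with `eb` EXHAUSTING
`Hom(M₂, ℤ/n)`: given an `𝒪`-linear `F`, choose `wⱼ` with `eb(wⱼ, ·) = lam(F(v^*ⱼ ⊗ ·))` and put `x = ∑ⱼ vⱼ ⊗ wⱼ`;
then `e(x, 1 ⊗ b) = ∑ⱼ ι(lam(F(v^*ⱼ ⊗ b))) vⱼ = ∑ⱼ ι(lam(F(1 ⊗ b) v^*ⱼ)) vⱼ = F(1 ⊗ b)` by the expansion formula,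
and both sides are `𝒪`-linear. [cite: Howard2004HeegnerKolyvagin, §1.3 (H.4, «perfect») and Lemma 2.1.1] [cite: DeSmitRubinSchoof1997, Prop. 2.1 / Cor. 2.2] -/
theorem scalarForm_surjective_of_expansion (hex : ∀ φ : M₂ →+ ZMod n, ∃ w : M₁, ∀ b : M₂, eb w b = φ b) :
    Function.Surjective (scalarForm ι eb : CoeffExtension ℤ 𝒪 M₁ → (CoeffExtension ℤ 𝒪 M₂ →ₗ[𝒪] 𝒪)) := by
  intro F
  -- the characters `b ↦ lam (F (v^*ⱼ ⊗ b))`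
  let φ : Fin d → (M₂ →+ ZMod n) := fun j =>
    lam.comp (F.toAddMonoidHom.comp (AddMonoidHom.mk' (fun b : M₂ => (CoeffExtension.tmul (vd j) b :
      CoeffExtension ℤ 𝒪 M₂)) (fun b b' => CoeffExtension.tmul_add' (vd j) b b')))
  have hφ : ∀ j b, φ j b = lam (F (CoeffExtension.tmul (vd j) b)) := fun j b => rfl
  choose w hw using fun j => hex (φ j)
  refine ⟨∑ j, CoeffExtension.tmul (v j) (w j), ?_⟩
  -- agreement on `1 ⊗ b`
  have key : ∀ b : M₂, scalarForm ι eb (∑ j, CoeffExtension.tmul (v j) (w j)) (CoeffExtension.tmul 1 b) =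
      F (CoeffExtension.tmul 1 b) := fun b => by
    rw [hexp (F (CoeffExtension.tmul 1 b)), map_sum, LinearMap.sum_apply]
    refine Finset.sum_congr rfl fun j _ => ?_
    rw [scalarForm_tmul_tmul, mul_one, hw j b, hφ, mul_comm]
    congr 3
    rw [mul_comm, ← smul_eq_mul, ← map_smul, CoeffExtension.smul_tmul_eq, mul_one]
  refine LinearMap.ext fun y => ?_
  induction y using CoeffExtension.induction_on with
  | zero => rw [map_zero, map_zero]
  | tmul c b =>
    have hc : (CoeffExtension.tmul c b : CoeffExtension ℤ 𝒪 M₂) = c • CoeffExtension.tmul 1 b := by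
      rw [CoeffExtension.smul_tmul_eq, mul_one]
    rw [hc, map_smul, map_smul, key]
  | add y y' hy hy' => rw [map_add, map_add, hy, hy']

include hδ hexp in
/-- **Perfectness** (the `perfect` field of `Howard2004.DualityDatum`): for Frobenius data `(lam, v, v^*)` on `𝒪` and
`eb : M₁ × M₂ → ℤ/n` left-non-degenerate and exhausting, `scalarForm ι eb : 𝒪 ⊗ M₁ → Hom_𝒪(𝒪 ⊗ M₂, 𝒪)` is a
bijection. [cite: Howard2004HeegnerKolyvagin, §1.3 (H.4, «perfect R-bilinear pairing») and Lemma 2.1.1]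
[cite: DeSmitRubinSchoof1997, Prop. 2.1 / Cor. 2.2] -/
theorem scalarForm_bijective_of_expansion (hnd : ∀ w : M₁, (∀ b : M₂, eb w b = 0) → w = 0)
    (hex : ∀ φ : M₂ →+ ZMod n, ∃ w : M₁, ∀ b : M₂, eb w b = φ b) :
    Function.Bijective (scalarForm ι eb : CoeffExtension ℤ 𝒪 M₁ → (CoeffExtension ℤ 𝒪 M₂ →ₗ[𝒪] 𝒪)) :=
  ⟨scalarForm_injective_of_expansion ι lam v vd hδ hexp eb hnd,
    scalarForm_surjective_of_expansion ι lam v vd hexp eb hex⟩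

end Perfect

end Literature.NumberTheory.EllipticCurves
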